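import Literature.Analysis.FluidPDE.NSCriticalClosureBesovProofs
import Literature.Analysis.FunctionSpaces.LittlewoodPaleySquareFunction
import Literature.Analysis.FunctionSpaces.LittlewoodPaleyKernel
import HarnessLib

/-!
# Littlewood–Paley blocks of `L^p` fields: the function-level dictionary

Support file for the Littlewood–Paley proof of Tao 2011, Prop. 9.1 (bounded total speed,
arXiv:1108.1165, §9; leaf `tao2011_duhamelNonlinearSpeed_unit` of `TaoBoundedTotalSpeed.lean`),
which manipulates the dyadic pieces `u_N = P_N u` of a velocity field as *functions* (products
`u_{N₁} u_{N₂}`, pointwise bounds, time integrals), whereas the tree's Littlewood–Paley library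
(`FunctionSpaces/LittlewoodPaley*`: Bernstein, almost orthogonality, convergence) is phrased for
the blocks `Δ̇_j : 𝓢' → 𝓢'` of tempered distributions. This file bridges the two for
`EuclideanSpace ℝ ι`-valued fields on a finite-dimensional inner product space `E`, through the
accepted representation predicate `IsDistributionOf` (`CriticalSpaces.lean`, complexification):

* `lpBlock_coe_eq_coe_blockFn`: for `f ∈ L^p(E; F)`, `Δ̇_j f` *is* the `L^p` class of the block
  function `blockFn j f = K_j ⋆ f` (BCD, proof of Lemma 2.1: `Δ̇_j u = h_j ⋆ u`);
  `IsDistributionOf.blockFn`: the block of the distribution of an `L^p` field is the distribution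
  of its block; `IsDistributionOf.eLpNormDistrib_eq`, `…_lpBlock_eq`: the distributional `L^q`
  norms are the `L^q` norms of the representing functions;
* `exists_eLpNorm_top_blockFn_le_two_rpow` (Bernstein `L² → L^∞` on a block, function level:
  `‖Δ̇_j f‖_∞ ≤ C 2^{jd/2} ‖Δ̇_j f‖₂`), `exists_eLpNorm_top_blockFn_le_eLpNorm` (Bernstein from
  `L^p`: `‖Δ̇_j F‖_∞ ≤ C 2^{jd/p} ‖F‖_p`, any `F ∈ L^p`);
* `exists_tsum_sq_blockFn_le_fderiv`: the gradient square function
  `∑_j 4^j ‖Δ̇_j f‖²_{L²} ≤ C ‖Df‖²_{L²}` for `C¹` fields `f ∈ L²` with `Df ∈ L²` (reverse Bernstein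
  block by block, `exists_eLpNormDistrib_lpBlock_le_sum_lineDeriv`, the distributional
  derivatives being the classical ones, `IsDistributionOf.lineDeriv`, and the almost orthogonality
  `tsum_eLpNormDistrib_lpBlock_sq_le` applied to the partial derivatives) — Tao's
  "`∑_N a_N² ≲ E₀`" step ("from (9.5) and Bessel's inequality (or the Plancherel theorem)");
* `tendsto_eLpNorm_sub_sum_blockFn`: `‖f − ∑_{|j| ≤ n} Δ̇_j f‖_{L²} → 0` for `f ∈ L²`.

No definitions are introduced.

## Mathlib / tree search

`lean search 'blockFn'`: the function-level block `FunctionSpaces.blockFn` (`LittlewoodPaleyKernel`)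
had Young-type bounds (`enorm_blockFn_le`, `eLpNorm_top_blockFn_le`) but no link to `lpBlock`
beyond `blockKernelC_convolution_eq_blockFn`; the link is `fourierMultiplierCLM_coe_apply_eq_integral_convolution`
(`LittlewoodPaleyBernsteinProofs`). Reused: `exists_eLpNormDistrib_lpBlock_le` (Bernstein),
`exists_eLpNormDistrib_lpBlock_le_eLpNormDistrib`, `exists_eLpNormDistrib_lpBlock_le_sum_lineDeriv`,
`IsDistributionOf.lineDeriv`, `isDistributionOf_toTemperedDistribution` (`NSCriticalClosureBesovProofs`,
`CriticalSpacesProofs`), `tsum_eLpNormDistrib_lpBlock_sq_le`, `tendsto_eLpNormDistrib_sub_sum_lpBlock`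
(`LittlewoodPaleySquareFunction`). Mathlib: `ENNReal.inner_le_Lp_mul_Lq`,
`Summable.tsum_finsetSum`, `MeasureTheory.Lp.ext`.

## References

* H. Bahouri, J.-Y. Chemin, R. Danchin, *Fourier Analysis and Nonlinear Partial Differential
  Equations*, Springer 2011 (`BahouriCheminDanchin2011`): Lemma 2.1 (Bernstein), (2.5) and
  Prop. 2.10–2.12 (the dyadic blocks, almost orthogonality).
* T. Tao, *Localisation and compactness properties of the Navier–Stokes global regularity
  problem*, arXiv:1108.1165 (`Tao2011`), §9, proof of Prop. 9.1 (p. 28: "`a_N := ‖∇u_N‖_{L²_tL²_x}`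
  … from (9.5) and Bessel's inequality one has `∑_N a_N² ≲ E₀`").
-/

noncomputable section

open MeasureTheory SchwartzMap Filter Topology
open scoped ENNReal NNReal FourierTransform

namespace Literature.Analysis.FluidPDE

open FunctionSpaces

section Bridge

variable {E : Type*} [NormedAddCommGroup E] [InnerProductSpace ℝ E] [FiniteDimensional ℝ E]
  [MeasurableSpace E] [BorelSpace E]
variable {F : Type*} [NormedAddCommGroup F] [NormedSpace ℂ F] [CompleteSpace F]

/-- **The block of an `L^p` function is the distribution of its block function**:
`Δ̇_j f = K_j ⋆ f` as tempered distributions for `f ∈ L^p(E; F)`, `1 ≤ p` (BCD, proof of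
Lemma 2.1, `Δ̇_j u = h_j ⋆ u`). [folklore] -/
theorem lpBlock_coe_eq_coe_blockFn {p : ℝ≥0∞} [hp : Fact (1 ≤ p)] (f : Lp F p (volume : Measure E))
    (j : ℤ) :
    lpBlock j (f : 𝓢'(E, F)) =
      ((memLp_blockFn j (Lp.memLp f) hp.out).toLp _ : Lp F p (volume : Measure E)) := by
  have hrep : lpBlock j (f : 𝓢'(E, F)) =
      TemperedDistribution.fourierMultiplierCLM F ⇑(dyadicSymbolSchwartz E j) (f : 𝓢'(E, F)) := by
    rw [lpBlock_apply, coe_dyadicSymbolSchwartz]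
  rw [hrep]
  ext u
  rw [fourierMultiplierCLM_coe_apply_eq_integral_convolution, Lp.toTemperedDistribution_apply]
  refine integral_congr_ae ?_
  filter_upwards [(memLp_blockFn j (Lp.memLp f) hp.out).coeFn_toLp] with y hy
  rw [hy]
  congr 1
  exact congrFun (blockKernelC_convolution_eq_blockFn j (f : E → F)) y

end Bridge

section Real

variable {ι : Type*} [Fintype ι]
variable {E : Type*} [NormedAddCommGroup E] [InnerProductSpace ℝ E] [FiniteDimensional ℝ E]
  [MeasurableSpace E] [BorelSpace E]

/-- Complexification commutes with the blocks of an `L^p` field. [folklore] -/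
theorem blockFn_complexify_comp {u₀ : E → EuclideanSpace ℝ ι} {p : ℝ≥0∞} [Fact (1 ≤ p)]
    (hu : MemLp u₀ p volume) (j : ℤ) :
    blockFn j (fun x => EuclideanSpace.complexify (u₀ x)) =
      fun x => EuclideanSpace.complexify (blockFn j u₀ x) :=
  blockFn_comp_clm j (EuclideanSpace.complexify (ι := ι)).toContinuousLinearMap hu

/-- **The block of the distribution of an `L^p` field is the distribution of its block.** [folklore] -/
theorem IsDistributionOf.blockFn {u₀ : E → EuclideanSpace ℝ ι} {W : 𝓢'(E, EuclideanSpace ℂ ι)}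
    (hW : IsDistributionOf u₀ W) {p : ℝ≥0∞} [Fact (1 ≤ p)] (hu : MemLp u₀ p volume) (j : ℤ) :
    IsDistributionOf (FunctionSpaces.blockFn j u₀) (lpBlock j W) := by
  have hb : MemLp (FunctionSpaces.blockFn j u₀) p volume := memLp_blockFn j hu (Fact.out)
  have hWeq : W = (((memLp_complexify_comp hu).toLp _ : Lp (EuclideanSpace ℂ ι) p volume) :
      𝓢'(E, EuclideanSpace ℂ ι)) :=
    hW.unique (isDistributionOf_toTemperedDistribution hu)
  have htarget := isDistributionOf_toTemperedDistribution (ι := ι) hb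
  suffices h : lpBlock j W = (((memLp_complexify_comp hb).toLp _ : Lp (EuclideanSpace ℂ ι) p volume) :
      𝓢'(E, EuclideanSpace ℂ ι)) by
    rw [h]; exact htarget
  rw [hWeq, lpBlock_coe_eq_coe_blockFn]
  congr 1
  refine Lp.ext ?_
  filter_upwards [MemLp.coeFn_toLp (memLp_blockFn j
      (Lp.memLp ((memLp_complexify_comp hu).toLp _ : Lp (EuclideanSpace ℂ ι) p volume))
      (Fact.out : 1 ≤ p)),
    MemLp.coeFn_toLp (memLp_complexify_comp hb)] with x hx hx'
  rw [hx, hx']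
  have hcongr : FunctionSpaces.blockFn j
      ((((memLp_complexify_comp hu).toLp _ : Lp (EuclideanSpace ℂ ι) p volume)) :
        E → EuclideanSpace ℂ ι) =
      FunctionSpaces.blockFn j (fun x => EuclideanSpace.complexify (u₀ x)) :=
    blockFn_congr_ae j (MemLp.coeFn_toLp _)
  rw [hcongr, blockFn_complexify_comp hu]

/-- The `L^q` norm of the distribution of a field is the `L^q` norm of the field, when the field
is in `L^q`. [folklore] -/
theorem IsDistributionOf.eLpNormDistrib_eq {u₀ : E → EuclideanSpace ℝ ι}
    {W : 𝓢'(E, EuclideanSpace ℂ ι)} (hW : IsDistributionOf u₀ W) {q : ℝ≥0∞} [Fact (1 ≤ q)]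
    (hq : MemLp u₀ q volume) : eLpNormDistrib q W = eLpNorm u₀ q volume := by
  rw [hW.unique (isDistributionOf_toTemperedDistribution hq), eLpNormDistrib_coe, Lp.enorm_def,
    eLpNorm_congr_ae (MemLp.coeFn_toLp _)]
  exact eLpNorm_congr_norm_ae (Eventually.of_forall fun x => EuclideanSpace.norm_complexify _)

/-- The `L^q` norm of the block of the distribution of an `L^p` field is the `L^q` norm of the
block of the field, when the latter is in `L^q`. [folklore] -/
theorem IsDistributionOf.eLpNormDistrib_lpBlock_eq {u₀ : E → EuclideanSpace ℝ ι}
    {W : 𝓢'(E, EuclideanSpace ℂ ι)} (hW : IsDistributionOf u₀ W) {p : ℝ≥0∞} [Fact (1 ≤ p)]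
    (hu : MemLp u₀ p volume) (j : ℤ) {q : ℝ≥0∞} [Fact (1 ≤ q)]
    (hq : MemLp (FunctionSpaces.blockFn j u₀) q volume) :
    eLpNormDistrib q (lpBlock j W) = eLpNorm (FunctionSpaces.blockFn j u₀) q volume :=
  (hW.blockFn hu j).eLpNormDistrib_eq hq

end Real

section Algebra

variable {ι : Type*} [Fintype ι]
variable {E : Type*} [NormedAddCommGroup E] [NormedSpace ℝ E] [MeasureSpace E]

/-- Distributions of fields add. [folklore] -/
theorem IsDistributionOf.add {u v : E → EuclideanSpace ℝ ι} {U V : 𝓢'(E, EuclideanSpace ℂ ι)}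
    (hu : IsDistributionOf u U) (hv : IsDistributionOf v V) : IsDistributionOf (u + v) (U + V) := by
  intro φ
  obtain ⟨hiu, hU⟩ := hu φ
  obtain ⟨hiv, hV⟩ := hv φ
  have heq : (fun x => φ x • EuclideanSpace.complexify ((u + v) x)) =
      fun x => φ x • EuclideanSpace.complexify (u x) + φ x • EuclideanSpace.complexify (v x) := by
    funext x
    simp only [Pi.add_apply, map_add, smul_add]
  refine ⟨by rw [heq]; exact hiu.add hiv, ?_⟩
  rw [show (U + V) φ = U φ + V φ from rfl, hU, hV, heq, integral_add hiu hiv]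

/-- Distributions of fields: finite sums. [folklore] -/
theorem IsDistributionOf.finset_sum {α : Type*} (s : Finset α) {u : α → E → EuclideanSpace ℝ ι}
    {U : α → 𝓢'(E, EuclideanSpace ℂ ι)} (h : ∀ a ∈ s, IsDistributionOf (u a) (U a)) :
    IsDistributionOf (∑ a ∈ s, u a) (∑ a ∈ s, U a) := by
  classical
  induction s using Finset.induction_on with
  | empty => simpa using isDistributionOf_zero (E := E) (ι := ι)
  | insert a s ha ih =>
    rw [Finset.sum_insert ha, Finset.sum_insert ha]
    exact (h a (Finset.mem_insert_self a s)).add (ih fun b hb => h b (Finset.mem_insert_of_mem hb))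

end Algebra

section Estimates

variable {ι : Type*} [Fintype ι]
variable {E : Type*} [NormedAddCommGroup E] [InnerProductSpace ℝ E] [FiniteDimensional ℝ E]
  [MeasurableSpace E] [BorelSpace E]

/-- A finite sum squared against the sum of squares: `(∑ a_i)² ≤ #α ∑ a_i²` in `ℝ≥0∞`
(Cauchy–Schwarz). [folklore] -/
theorem ennreal_sq_sum_univ_le {α : Type*} [Fintype α] (a : α → ℝ≥0∞) :
    (∑ i, a i) ^ 2 ≤ Fintype.card α * ∑ i, a i ^ 2 := by
  have h := ENNReal.inner_le_Lp_mul_Lq Finset.univ a (fun _ => (1 : ℝ≥0∞))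
    (Real.HolderConjugate.two_two)
  simp only [mul_one, one_pow, Finset.sum_const, Finset.card_univ, nsmul_eq_mul,
    ENNReal.rpow_two] at h
  calc (∑ i, a i) ^ 2
      ≤ ((∑ i, a i ^ (2 : ℝ)) ^ (1 / 2 : ℝ) * ((Fintype.card α : ℝ≥0∞)) ^ (1 / 2 : ℝ)) ^ 2 := by
        gcongr
        simpa using h
    _ = Fintype.card α * ∑ i, a i ^ 2 := by
        rw [mul_pow, ← ENNReal.rpow_natCast, ← ENNReal.rpow_natCast, ← ENNReal.rpow_mul,
          ← ENNReal.rpow_mul]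
        norm_num
        rw [mul_comm]

/-- **Bernstein's inequality for the blocks of `L²` fields, function level**:
`‖Δ̇_j f‖_{L^∞} ≤ C 2^{jd/2} ‖Δ̇_j f‖_{L²}` (`d = dim E`; BCD Lemma 2.1). [cite: BahouriCheminDanchin2011, Lemma 2.1] -/
theorem exists_eLpNorm_top_blockFn_le_two_rpow :
    ∃ C : ℝ≥0, ∀ (j : ℤ) ⦃f : E → EuclideanSpace ℝ ι⦄, MemLp f 2 volume →
      eLpNorm (blockFn j f) ∞ volume ≤
        C * (2 : ℝ≥0∞) ^ ((j : ℝ) * Module.finrank ℝ E / 2) * eLpNorm (blockFn j f) 2 volume := by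
  obtain ⟨C, -, hC⟩ := exists_eLpNormDistrib_lpBlock_le (E := E) (F := EuclideanSpace ℂ ι) 2 ∞ le_top
  refine ⟨C, fun j f hf => ?_⟩
  have hW := isDistributionOf_toTemperedDistribution (ι := ι) hf
  have h2 : MemLp (blockFn j f) 2 volume := memLp_blockFn j hf one_le_two
  have htop : MemLp (blockFn j f) ∞ volume := memLp_top_blockFn j hf
  rw [← hW.eLpNormDistrib_lpBlock_eq hf j htop, ← hW.eLpNormDistrib_lpBlock_eq hf j h2]
  have hexp : (j : ℝ) * Module.finrank ℝ E * ((2 : ℝ≥0∞).toReal⁻¹ - (∞ : ℝ≥0∞).toReal⁻¹) =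
      (j : ℝ) * Module.finrank ℝ E / 2 := by
    simp only [ENNReal.toReal_ofNat, ENNReal.toReal_top, inv_zero, sub_zero]
    ring
  have h := hC j (Lp.toTemperedDistribution ((memLp_complexify_comp hf).toLp _))
  rwa [hexp] at h

/-- **Bernstein's inequality from `L^p` to `L^∞` for the blocks of `L^p` fields, function level**:
`‖Δ̇_j F‖_{L^∞} ≤ C 2^{jd/p} ‖F‖_{L^p}` for `F ∈ L^p`, `1 ≤ p ≤ ∞` (BCD Lemma 2.1 and the uniform
`L^p` bound of the blocks). [cite: BahouriCheminDanchin2011, Lemma 2.1] -/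
theorem exists_eLpNorm_top_blockFn_le_eLpNorm (p : ℝ≥0∞) [Fact (1 ≤ p)] :
    ∃ C : ℝ≥0, ∀ (j : ℤ) ⦃F : E → EuclideanSpace ℝ ι⦄, MemLp F p volume →
      eLpNorm (blockFn j F) ∞ volume ≤
        C * (2 : ℝ≥0∞) ^ ((j : ℝ) * Module.finrank ℝ E * p.toReal⁻¹) * eLpNorm F p volume := by
  obtain ⟨CB, -, hCB⟩ := exists_eLpNormDistrib_lpBlock_le (E := E) (F := EuclideanSpace ℂ ι) p ∞ le_top
  obtain ⟨CA, hCA⟩ := exists_eLpNormDistrib_lpBlock_le_eLpNormDistrib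
    (E := E) (F := EuclideanSpace ℂ ι) p
  refine ⟨CB * CA, fun j F hF => ?_⟩
  have hW := isDistributionOf_toTemperedDistribution (ι := ι) hF
  set W : 𝓢'(E, EuclideanSpace ℂ ι) :=
    Lp.toTemperedDistribution ((memLp_complexify_comp hF).toLp _) with hWdef
  have htop : MemLp (blockFn j F) ∞ volume := memLp_top_blockFn j hF
  rw [← hW.eLpNormDistrib_lpBlock_eq hF j htop, ← hW.eLpNormDistrib_eq hF]
  have hexp : (j : ℝ) * Module.finrank ℝ E * (p.toReal⁻¹ - (∞ : ℝ≥0∞).toReal⁻¹) =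
      (j : ℝ) * Module.finrank ℝ E * p.toReal⁻¹ := by
    simp only [ENNReal.toReal_top, inv_zero, sub_zero]
  calc eLpNormDistrib ∞ (lpBlock j W)
      ≤ CB * (2 : ℝ≥0∞) ^ ((j : ℝ) * Module.finrank ℝ E * (p.toReal⁻¹ - (∞ : ℝ≥0∞).toReal⁻¹)) *
          eLpNormDistrib p (lpBlock j W) := hCB j W
    _ ≤ CB * (2 : ℝ≥0∞) ^ ((j : ℝ) * Module.finrank ℝ E * (p.toReal⁻¹ - (∞ : ℝ≥0∞).toReal⁻¹)) *
          (CA * eLpNormDistrib p W) := by gcongr; exact hCA j W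
    _ = ((CB * CA : ℝ≥0) : ℝ≥0∞) * (2 : ℝ≥0∞) ^ ((j : ℝ) * Module.finrank ℝ E * p.toReal⁻¹) *
          eLpNormDistrib p W := by
        rw [hexp]
        push_cast
        ring

/-- **The gradient square function, function level**: `∑_j 4^j ‖Δ̇_j f‖²_{L²} ≤ C ‖Df‖²_{L²}` for
`C¹` fields `f ∈ L²` with `Df ∈ L²` (reverse Bernstein block by block, BCD Lemma 2.1/2.2, and the
almost orthogonality of the blocks in `L²` applied to the partial derivatives). [cite: BahouriCheminDanchin2011, Lemma 2.1 + (2.5)] -/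
theorem exists_tsum_sq_blockFn_le_fderiv :
    ∃ C : ℝ≥0, ∀ ⦃f : E → EuclideanSpace ℝ ι⦄, ContDiff ℝ 1 f → MemLp f 2 volume →
      MemLp (fderiv ℝ f) 2 volume →
      ∑' j : ℤ, ((2 : ℝ≥0∞) ^ (j : ℝ)) ^ 2 * eLpNorm (blockFn j f) 2 volume ^ 2 ≤
        C * eLpNorm (fderiv ℝ f) 2 volume ^ 2 := by
  set d : ℕ := Module.finrank ℝ E with hd
  set b : OrthonormalBasis (Fin d) ℝ E := stdOrthonormalBasis ℝ E with hb
  obtain ⟨CB, hCB⟩ := exists_eLpNormDistrib_lpBlock_le_sum_lineDeriv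
    (E := E) (F := EuclideanSpace ℂ ι) 2 b
  refine ⟨CB ^ 2 * d * (d * 8), fun f hf hf2 hDf => ?_⟩
  have hW := isDistributionOf_toTemperedDistribution (ι := ι) hf2
  set W : 𝓢'(E, EuclideanSpace ℂ ι) :=
    Lp.toTemperedDistribution ((memLp_complexify_comp hf2).toLp _) with hWdef
  -- the partial derivatives as `L²` fields with distributions `∂_i W`
  have hcont : Continuous (fderiv ℝ f) := hf.continuous_fderiv one_ne_zero
  have hptw : ∀ (i : Fin d) (x : E), ‖fderiv ℝ f x (b i)‖ ≤ ‖fderiv ℝ f x‖ := fun i x => by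
    simpa [b.orthonormal.1 i] using (fderiv ℝ f x).le_opNorm (b i)
  have hfi : ∀ i : Fin d, MemLp (fun x => fderiv ℝ f x (b i)) 2 volume := fun i =>
    MemLp.of_le hDf (hcont.clm_apply continuous_const).aestronglyMeasurable
      (Eventually.of_forall fun x => hptw i x)
  have hWi : ∀ i : Fin d, IsDistributionOf (fun x => fderiv ℝ f x (b i)) (LineDeriv.lineDerivOp (b i) W) := fun i =>
    hW.lineDeriv hf hf2 (b i) (hfi i)
  -- square function for each partial derivative
  have hsq : ∀ i : Fin d, ∑' j : ℤ, eLpNormDistrib 2 (lpBlock j (LineDeriv.lineDerivOp (b i) W)) ^ 2 ≤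
      8 * eLpNorm (fderiv ℝ f) 2 volume ^ 2 := by
    intro i
    set G : Lp (EuclideanSpace ℂ ι) 2 (volume : Measure E) := (memLp_complexify_comp (hfi i)).toLp _
    have hG : LineDeriv.lineDerivOp (b i) W = (G : 𝓢'(E, EuclideanSpace ℂ ι)) :=
      (hWi i).unique (isDistributionOf_toTemperedDistribution (hfi i))
    have hGn : ‖G‖ₑ ≤ eLpNorm (fderiv ℝ f) 2 volume := by
      rw [Lp.enorm_def, eLpNorm_congr_ae (MemLp.coeFn_toLp _)]
      calc eLpNorm (fun x => EuclideanSpace.complexify (fderiv ℝ f x (b i))) 2 volume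
          = eLpNorm (fun x => fderiv ℝ f x (b i)) 2 volume :=
            eLpNorm_congr_norm_ae (Eventually.of_forall fun x => EuclideanSpace.norm_complexify _)
        _ ≤ eLpNorm (fderiv ℝ f) 2 volume := eLpNorm_mono fun x => hptw i x
    rw [hG]
    exact (tsum_eLpNormDistrib_lpBlock_sq_le G).trans (by gcongr)
  -- block by block
  have hblock : ∀ j : ℤ, ((2 : ℝ≥0∞) ^ (j : ℝ)) ^ 2 * eLpNorm (blockFn j f) 2 volume ^ 2 ≤
      (CB : ℝ≥0∞) ^ 2 * d * ∑ i, eLpNormDistrib 2 (lpBlock j (LineDeriv.lineDerivOp (b i) W)) ^ 2 := by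
    intro j
    have h2 : MemLp (blockFn j f) 2 volume := memLp_blockFn j hf2 one_le_two
    rw [← hW.eLpNormDistrib_lpBlock_eq hf2 j h2]
    have h := hCB j W
    have hcs : (∑ i, eLpNormDistrib 2 (lpBlock j (LineDeriv.lineDerivOp (b i) W))) ^ 2 ≤
        d * ∑ i, eLpNormDistrib 2 (lpBlock j (LineDeriv.lineDerivOp (b i) W)) ^ 2 := by
      have h1 := ennreal_sq_sum_univ_le
        (fun i : Fin d => eLpNormDistrib 2 (lpBlock j (LineDeriv.lineDerivOp (b i) W)))
      rwa [Fintype.card_fin] at h1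
    calc ((2 : ℝ≥0∞) ^ (j : ℝ)) ^ 2 * eLpNormDistrib 2 (lpBlock j W) ^ 2
        ≤ ((2 : ℝ≥0∞) ^ (j : ℝ)) ^ 2 *
            ((CB : ℝ≥0∞) * (2 : ℝ≥0∞) ^ (-(j : ℝ)) * ∑ i, eLpNormDistrib 2 (lpBlock j (LineDeriv.lineDerivOp (b i) W))) ^ 2 := by
          gcongr
      _ = (CB : ℝ≥0∞) ^ 2 * (((2 : ℝ≥0∞) ^ (j : ℝ) * (2 : ℝ≥0∞) ^ (-(j : ℝ))) ^ 2 *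
            (∑ i, eLpNormDistrib 2 (lpBlock j (LineDeriv.lineDerivOp (b i) W))) ^ 2) := by ring
      _ = (CB : ℝ≥0∞) ^ 2 * (∑ i, eLpNormDistrib 2 (lpBlock j (LineDeriv.lineDerivOp (b i) W))) ^ 2 := by
          rw [two_rpow_mul_two_rpow, add_neg_cancel, ENNReal.rpow_zero, one_pow, one_mul]
      _ ≤ (CB : ℝ≥0∞) ^ 2 * (d * ∑ i, eLpNormDistrib 2 (lpBlock j (LineDeriv.lineDerivOp (b i) W)) ^ 2) := by
          gcongr
      _ = (CB : ℝ≥0∞) ^ 2 * d * ∑ i, eLpNormDistrib 2 (lpBlock j (LineDeriv.lineDerivOp (b i) W)) ^ 2 := by ring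
  -- summation over `j`
  calc ∑' j : ℤ, ((2 : ℝ≥0∞) ^ (j : ℝ)) ^ 2 * eLpNorm (blockFn j f) 2 volume ^ 2
      ≤ ∑' j : ℤ, (CB : ℝ≥0∞) ^ 2 * d * ∑ i, eLpNormDistrib 2 (lpBlock j (LineDeriv.lineDerivOp (b i) W)) ^ 2 :=
        ENNReal.tsum_le_tsum hblock
    _ = (CB : ℝ≥0∞) ^ 2 * d * ∑ i, ∑' j : ℤ, eLpNormDistrib 2 (lpBlock j (LineDeriv.lineDerivOp (b i) W)) ^ 2 := by
        rw [ENNReal.tsum_mul_left]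
        congr 1
        exact Summable.tsum_finsetSum fun i _ => ENNReal.summable
    _ ≤ (CB : ℝ≥0∞) ^ 2 * d * ∑ _i : Fin d, 8 * eLpNorm (fderiv ℝ f) 2 volume ^ 2 := by
        gcongr with i
        exact hsq i
    _ = ((CB ^ 2 * d * (d * 8) : ℝ≥0) : ℝ≥0∞) * eLpNorm (fderiv ℝ f) 2 volume ^ 2 := by
        rw [Finset.sum_const, Finset.card_univ, Fintype.card_fin, nsmul_eq_mul]
        push_cast
        ring

/-- **`L²` convergence of the Littlewood–Paley decomposition, function level**:
`‖f − ∑_{|j| ≤ n} Δ̇_j f‖_{L²} → 0` for `f ∈ L²` (Plancherel and dominated convergence). [cite: BahouriCheminDanchin2011, Prop. 2.12] -/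
theorem tendsto_eLpNorm_sub_sum_blockFn [Nontrivial E] ⦃f : E → EuclideanSpace ℝ ι⦄
    (hf : MemLp f 2 volume) :
    Tendsto (fun n : ℕ => eLpNorm (f - ∑ j ∈ Finset.Icc (-(n : ℤ)) n, blockFn j f) 2 volume)
      atTop (𝓝 0) := by
  have hW := isDistributionOf_toTemperedDistribution (ι := ι) hf
  set G : Lp (EuclideanSpace ℂ ι) 2 (volume : Measure E) := (memLp_complexify_comp hf).toLp _ with hG
  have h := tendsto_eLpNormDistrib_sub_sum_lpBlock G
  refine (tendsto_congr fun n => ?_).1 h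
  have hsum : IsDistributionOf (∑ j ∈ Finset.Icc (-(n : ℤ)) n, blockFn j f)
      (∑ j ∈ Finset.Icc (-(n : ℤ)) n, lpBlock j (G : 𝓢'(E, EuclideanSpace ℂ ι))) :=
    IsDistributionOf.finset_sum _ fun j _ => hW.blockFn hf j
  have hdiff := hW.sub hsum
  have hmem : MemLp (f - ∑ j ∈ Finset.Icc (-(n : ℤ)) n, blockFn j f) 2 volume :=
    hf.sub (memLp_finsetSum' _ fun j _ => memLp_blockFn j hf one_le_two)
  exact hdiff.eLpNormDistrib_eq hmem

end Estimates

end Literature.Analysis.FluidPDE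

end
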